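import Summits.HodgeConjecture.HodgeConjecture.Theses.NikulinTwinTransport
import Summits.HodgeConjecture.HodgeConjecture.Theorems.NikulinTwinTransportHodgeIsometryAlgebraic
import Summits.HodgeConjecture.HodgeConjecture.Theorems.NikulinTwinTransportTwinSimilitudeReduction
import Literature.AlgebraicGeometry.HodgeTheory.GysinBaseChange

/-!
# Route NikulinTwinTransport · item `HodgeIsometryAlgebraic` (stmt-HodgeConjecture-13675) —
# Buskin's Lemma 6.3 discharged: the item modulo the period facts, Prop. 6.2 and `hCUP` only

The reduction `hodgeIsometryAlgebraic_of_reflective` (`Theorems/NikulinTwinTransportHodgeIsometryAlgebraic`)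
derives the item from the named facts `Huybrechts_K3_periodSurjective_projective`,
`Huybrechts_K3_marking_exists`, Buskin's Prop. 6.2 for reflective isometries at one orientation
family (`hrefl`) and his Lemma 6.3 (`hcomp`: composition of algebraic correspondences between K3
surfaces). Lemma 6.3 is now a THEOREM of the tree modulo the multiplicativity of algebraic classes:
`Literature.AlgebraicGeometry.HodgeTheory.corrComp_surfaces_of_cup` (file
`HodgeTheory/GysinBaseChange`: Fulton §16.1 composition `corr_comp_of_baseChange`
+ the Gysin base change `gysin_baseChange`, itself from the Künneth formula `LerayHirsch.kunneth_mem_span_of_field` of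
`AlgebraicTopology/SingularHomology/KunnethFormula`),
GRANTED only `hCUP` : `N² ∪ N² ⊆ N⁴` on triple products of surfaces (Voisin II Prop. 9.20 — the
moving-lemma input, a hypothesis in the tree by design, `AlgebraicClassesCup`). Hence:

* `hodgeIsometryAlgebraic_of_reflective_of_cup` — the item from the two period facts, `hrefl` and
  `hCUP`;
* `twinSimilitudeAlgebraic_of_anchor_of_cup` — the route's target (stmt-HodgeConjecture-13674) from
  the item, `hCUP` and the algebraic anchor `2`-similitude (A) — hypothesis (C) of the glue
  `twinSimilitudeAlgebraic_of_anchor` being discharged by `corrComp_surfaces_of_cup'`.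

Conditional results (named facts + inline hypotheses `hrefl`, `hCUP`, (A)).

## References

* [Buskin2019] N. Buskin, Every rational Hodge isometry between two K3 surfaces is algebraic,
  J. reine angew. Math. 755 (2019), Thm. 1.1, §6.2 Prop. 6.2, Lemma 6.3.
* [VoisinHodgeII2003] C. Voisin, Hodge Theory and Complex Algebraic Geometry II, CUP 2003, §9.2.4 Prop. 9.20.
* [HatcherAT2002] A. Hatcher, Algebraic Topology, CUP 2002, §3.2 Thm. 3.15.
* [Huybrechts2016K3] D. Huybrechts, Lectures on K3 Surfaces, CUP 2016, Ch. 1 Prop. 3.5.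
-/

noncomputable section

open CategoryTheory AlgebraicGeometry MonoidalCategory CartesianMonoidalCategory
open Literature.AlgebraicGeometry.Motives Literature.AlgebraicGeometry.HodgeTheory
open Literature.AlgebraicGeometry.Surfaces Literature.Geometry.Kaehler
open Literature.AlgebraicTopology.SingularHomology
open scoped Manifold

namespace Summit.HodgeConjecture.HodgeConjecture.Theorems.NikulinTwinTransport

/-- `MarkedK3[S, η, p, x]`: a marked K3 surface with period `x` (copied from
`Theorems/NikulinTwinTransportHodgeIsometryAlgebraic`). Local notation only. -/
local notation3 (prettyPrint := false) "MarkedK3[" S ", " η ", " p ", " x "]" =>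
  (IsIntegralClass p ∧
    (∀ q : complexBetti S (2 * 2), IsIntegralClass q → ∃ n : ℤ, q = n • p) ∧
    (∀ c : complexBetti S (2 * 1), IsIntegralClass c ↔ ∃ v : K3Index → ℤ, η c = fun i => (v i : ℂ)) ∧
    (∀ a b : complexBetti S (2 * 1),
        cupProduct (rfl : 2 * 1 + 2 * 1 = 2 * 2) a b = k3Form (η a) (η b) • p) ∧
    IsOfHodgeType 2 S (2 * 1) 2 0 (LinearEquiv.symm η x) ∧
    (∀ τ : complexBetti S (2 * 1), IsOfHodgeType 2 S (2 * 1) 2 0 τ → ∃ t : ℂ, τ = t • LinearEquiv.symm η x))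

/-- `PeriodPt[x]`: a projective period point (copied from
`Theorems/NikulinTwinTransportHodgeIsometryAlgebraic`). Local notation only. -/
local notation3 (prettyPrint := false) "PeriodPt[" x "]" =>
  (k3Form x x = 0 ∧ 0 < (k3Form (star x) x).re ∧
    ∃ u : K3Index → ℤ, k3Form (fun i => (u i : ℂ)) x = 0 ∧ 0 < ∑ i, ∑ j, u i * k3Gram i j * u j)

/-- `Corr[μ, S, S', hS, hS' ; γ, y] = [γ]_* y = fst_* (snd^* y ∪ γ)` (copied from
`Theorems/NikulinTwinTransportHodgeIsometryAlgebraic`). Local notation only. -/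
local notation3 (prettyPrint := false) "Corr[" μ ", " S ", " S' ", " hS ", " hS' " ; " γ ", " y "]" =>
  complexGysin μ
    (IsSmoothProjective.tensor_holds (IsK3Surface.isSmoothProjective hS)
      (IsK3Surface.isSmoothProjective hS'))
    (IsK3Surface.isSmoothProjective hS) (SemiCartesianMonoidalCategory.fst S S')
    (rfl : 2 * 1 + 2 * 2 + 2 * 2 = 2 * 1 + 2 * (2 + 2))
    (cupProduct (rfl : 2 * 1 + 2 * 2 = 2 * 1 + 2 * 2)
      (complexBetti.map (SemiCartesianMonoidalCategory.snd S S') (2 * 1) y) γ)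

/-! ### The item and the target, with Lemma 6.3 discharged -/

/-- **The item `HodgeIsometryAlgebraic` from the period facts, Buskin's Prop. 6.2 and `hCUP`**:
the named facts `Huybrechts_K3_periodSurjective_projective`, `Huybrechts_K3_marking_exists`,
Buskin's Prop. 6.2 for reflective isometries at one orientation family `μ₀` (`hrefl`) and the
multiplicativity `N² ∪ N² ⊆ N⁴` on triple products of surfaces (`hCUP`, the moving-lemma input);
Buskin's Lemma 6.3 (the former hypothesis `hcomp`) is the theorem `corrComp_surfaces_of_cup`.
Conditional. [cite: Buskin2019, Thm. 1.1 and §6.2 (Prop. 6.2, Lemma 6.3)]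
[cite: VoisinHodgeII2003, §9.2.4 Prop. 9.20] -/
theorem hodgeIsometryAlgebraic_of_reflective_of_cup (μ₀ : OrientationFamily)
    (h : Huybrechts_K3_periodSurjective_projective) (hmark : Huybrechts_K3_marking_exists)
    (hrefl : ∀ (S S' : SchemeOver ℂ) (hS : IsK3Surface S) (hS' : IsK3Surface S')
      (η : complexBetti S (2 * 1) ≃ₗ[ℂ] (K3Index → ℂ)) (p : complexBetti S (2 * 2)) (x : K3Index → ℂ)
      (η' : complexBetti S' (2 * 1) ≃ₗ[ℂ] (K3Index → ℂ)) (p' : complexBetti S' (2 * 2))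
      (x' : K3Index → ℂ),
      MarkedK3[S, η, p, x] → PeriodPt[x] → MarkedK3[S', η', p', x'] → PeriodPt[x'] →
      ∀ v : K3Index → ℤ, ∑ i, ∑ j, v i * k3Gram i j * v j ≠ 0 →
      (∃ t : ℂ, k3ReflectionC v x' = t • x) →
      ∃ γ ∈ algebraicClasses (S ⊗ S') 2, ∀ y : complexBetti S' (2 * 1),
        η.symm (k3ReflectionC v (η' y)) = Corr[μ₀, S, S', hS, hS' ; γ, y])
    (hCUP : ∀ (A B C : SchemeOver ℂ), IsSmoothProjective 2 A → IsSmoothProjective 2 B →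
      IsSmoothProjective 2 C →
      ∀ a ∈ algebraicClasses (A ⊗ (B ⊗ C)) 2, ∀ b ∈ algebraicClasses (A ⊗ (B ⊗ C)) 2,
        cupProduct ((Nat.mul_add 2 2 2).symm : 2 * 2 + 2 * 2 = 2 * (2 + 2)) a b ∈
          algebraicClasses (A ⊗ (B ⊗ C)) (2 + 2)) :
    Theses.NikulinTwinTransport.HodgeIsometryAlgebraic :=
  hodgeIsometryAlgebraic_of_reflective μ₀ h hmark hrefl fun S S' S'' hS hS' hS'' γ hγ γ' hγ' ↦
    corrComp_surfaces_of_cup μ₀ hCUP S S' S'' hS.1 hS'.1 hS''.1 γ hγ γ' hγ'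

/-- **The route's target `TwinSimilitudeAlgebraic` (stmt-HodgeConjecture-13674) from the item,
`hCUP` and the algebraic anchor `2`-similitude (A)** — hypothesis (C) of the glue
`twinSimilitudeAlgebraic_of_anchor` (composition of algebraic correspondences between smooth
projective surfaces) is the theorem `corrComp_surfaces_of_cup'`. Conditional.
[cite: Buskin2019, Thm. 1.1 and Lemma 6.3] [cite: VoisinHodgeII2003, §9.2.4 Prop. 9.20] -/
theorem twinSimilitudeAlgebraic_of_anchor_of_cup
    (hB : Theses.NikulinTwinTransport.HodgeIsometryAlgebraic)
    (hCUP : ∀ (A B C : SchemeOver ℂ), IsSmoothProjective 2 A → IsSmoothProjective 2 B →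
      IsSmoothProjective 2 C →
      ∀ a ∈ algebraicClasses (A ⊗ (B ⊗ C)) 2, ∀ b ∈ algebraicClasses (A ⊗ (B ⊗ C)) 2,
        cupProduct ((Nat.mul_add 2 2 2).symm : 2 * 2 + 2 * 2 = 2 * (2 + 2)) a b ∈
          algebraicClasses (A ⊗ (B ⊗ C)) (2 + 2))
    (hA : ∀ (μ : OrientationFamily), μ.HasPoincareDuality →
      ∀ (S : SchemeOver ℂ)
        (hS : (IsSmoothProjective 2 S ∧ Subsingleton (structureSheafCohomology S.left 1) ∧
          ∃ (A : HodgeModel 2 S) (η : MForm 𝓘(ℝ, A.model) A.carrier ℂ 2),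
            IsHolomorphicInCharts η ∧ ∀ x, η x ≠ 0))
        (p : complexBetti S (2 * 2)),
        (IsIntegralClass p ∧ ∀ q : complexBetti S (2 * 2), IsIntegralClass q → ∃ n : ℤ, q = n • p) →
        ∃ (S'' : SchemeOver ℂ)
          (hS'' : (IsSmoothProjective 2 S'' ∧ Subsingleton (structureSheafCohomology S''.left 1) ∧
            ∃ (A : HodgeModel 2 S'') (η : MForm 𝓘(ℝ, A.model) A.carrier ℂ 2),
              IsHolomorphicInCharts η ∧ ∀ x, η x ≠ 0))
          (p'' : complexBetti S'' (2 * 2)),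
          (IsIntegralClass p'' ∧
            ∀ q : complexBetti S'' (2 * 2), IsIntegralClass q → ∃ n : ℤ, q = n • p'') ∧
          ∃ Ψ : complexBetti S'' (2 * 1) ≃ₗ[ℂ] complexBetti S (2 * 1),
            (∀ y, IsRationalClass y → IsRationalClass (Ψ.symm y)) ∧
            (∀ (i j : ℕ) y, IsOfHodgeType 2 S (2 * 1) i j y →
              IsOfHodgeType 2 S'' (2 * 1) i j (Ψ.symm y)) ∧
            (∀ (u v : complexBetti S (2 * 1)) (b : ℂ),
              cupProduct (rfl : 2 * 1 + 2 * 1 = 2 * 2) u v = (2 * b) • p →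
                cupProduct (rfl : 2 * 1 + 2 * 1 = 2 * 2) (Ψ.symm u) (Ψ.symm v) = b • p'') ∧
            ∃ γ ∈ algebraicClasses (MonoidalCategoryStruct.tensorObj S S'') 2,
              ∀ x : complexBetti S'' (2 * 1),
                Ψ x = complexGysin μ (IsSmoothProjective.tensor_holds hS.1 hS''.1) hS.1
                  (SemiCartesianMonoidalCategory.fst S S'')
                  (rfl : 2 * 1 + 2 * 2 + 2 * 2 = 2 * 1 + 2 * (2 + 2))
                  (cupProduct (rfl : 2 * 1 + 2 * 2 = 2 * 1 + 2 * 2)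
                    (complexBetti.map (SemiCartesianMonoidalCategory.snd S S'') (2 * 1) x) γ)) :
    Theses.NikulinTwinTransport.TwinSimilitudeAlgebraic :=
  twinSimilitudeAlgebraic_of_anchor hB (corrComp_surfaces_of_cup' hCUP) hA

end Summit.HodgeConjecture.HodgeConjecture.Theorems.NikulinTwinTransport

end
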